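import Mathlib
import Literature.AlgebraicGeometry.Resolution.RsopMonomialIdeals

/-!
# TropicalLinks / InductiveStep — regularity test along a frame

Route `ResolutionOfSingularities/TropicalLinks`, crux `InductiveStep` (stmt-ResolutionOfSingularities-17233),
line `split`, producer brick L2, in support of the geometric producer `stub_valuativeCharts`.

Setting: `O` is a local ring, `K` its fraction field, and `z : Fin r → O` is part of a regular system
of parameters (`IsRsopPart z`; the `z l` are pairwise non-associated prime elements of the regular
local ring `O`, and `(∏ z l) = ⋂ (z l)`). In the route, `O` is the local ring of the regular projective
closure at a point `Q` and the `z l` are local equations of the boundary divisors through `Q`.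

* `tropicalLinks_frame_mem_of_forall_mem_localization` — **regularity test along a frame.** A
  fraction `x : K` that is regular off the boundary (`x · (∏ z)^t ∈ O`) and has no pole along each
  boundary divisor (`x ∈ O_{(z l)}` for every `l`, written as `x · s = b` with `s ∉ (z l)`) lies in `O`.
  Proof: induction on `t`; in the step, `x (∏ z)^(t+1) = a` and `x s = b` give `a s = b (∏ z)^(t+1)` in
  `O`, so the prime `z l ∤ s` divides `a` for every `l`, hence `(∏ z) ∣ a` (`IsRsopPart.span_prod_eq_iInf`)
  and one factor `∏ z ≠ 0` cancels in the field `K`.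
-/

-- single-problem summit: the doubled namespace component `ResolutionOfSingularities` is forced
set_option linter.dupNamespace false

namespace Summit.ResolutionOfSingularities.ResolutionOfSingularities.Theorems

open Literature.AlgebraicGeometry.Resolution

/-- **Regularity test along a frame.** Let `O` be a local ring with fraction field `K` and
`z : Fin r → O` part of a regular system of parameters. If `x : K` satisfies
`x · (∏ z l)^t = a ∈ O` and, for every `l`, `x · s = b` for some `b, s ∈ O` with `s ∉ (z l)`
(i.e. `x` lies in the localization of `O` at the height-one prime `(z l)`), then `x ∈ O`.
[folklore] -/
theorem tropicalLinks_frame_mem_of_forall_mem_localization :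
    ∀ (O : Type) [CommRing O] [IsLocalRing O] (K : Type) [Field K] [Algebra O K] [IsFractionRing O K] (r : ℕ) (z : Fin r → O), Literature.AlgebraicGeometry.Resolution.IsRsopPart z → ∀ (x : K) (t : ℕ) (a : O), x * algebraMap O K (∏ l, z l) ^ t = algebraMap O K a → (∀ l : Fin r, ∃ (b s : O), s ∉ Ideal.span {z l} ∧ x * algebraMap O K s = algebraMap O K b) → ∃ a₀ : O, x = algebraMap O K a₀ := by
  intro O _ _ K _ _ _ r z hz x t
  haveI := hz.isRegularLocalRing
  haveI : IsDomain O := isDomain_of_isRegularLocalRing O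
  have hinj : Function.Injective (algebraMap O K) := IsFractionRing.injective O K
  -- `∏ z ≠ 0` in the domain `O`, hence its image is non-zero in `K`
  have hP0 : (∏ l, z l : O) ≠ 0 := Finset.prod_ne_zero_iff.mpr fun l _ => hz.ne_zero l
  have hPK : algebraMap O K (∏ l, z l) ≠ 0 := fun h =>
    hP0 ((IsFractionRing.to_map_eq_zero_iff (K := K)).mp h)
  induction t with
  | zero =>
    intro a ha _
    exact ⟨a, by simpa using ha⟩
  | succ t ih =>
    intro a ha hloc
    -- `(∏ z) ∣ a`: every prime `z l` divides `a`, and `(∏ z) = ⋂ (z l)`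
    have hdvd : (∏ l, z l) ∣ a := by
      have hmem : a ∈ ⨅ l, Ideal.span {z l} := by
        refine Ideal.mem_iInf.mpr fun l => ?_
        obtain ⟨b, s, hs, hxs⟩ := hloc l
        rw [Ideal.mem_span_singleton] at hs ⊢
        -- `a s = b (∏ z)^(t+1)` in `O` (checked in `K`)
        have h1 : a * s = b * (∏ l, z l) ^ (t + 1) := by
          apply hinj
          simp only [map_mul, map_pow]
          rw [← ha, ← hxs]
          ring
        have h2 : z l ∣ a * s := by
          rw [h1]
          exact dvd_mul_of_dvd_right
            (dvd_pow (Finset.dvd_prod_of_mem _ (Finset.mem_univ l)) (Nat.succ_ne_zero t)) b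
        exact ((hz.prime l).dvd_or_dvd h2).resolve_right hs
      rw [← hz.span_prod_eq_iInf] at hmem
      exact Ideal.mem_span_singleton.mp hmem
    obtain ⟨a', rfl⟩ := hdvd
    -- cancel one factor `∏ z` in `K` and conclude by induction
    refine ih a' ?_ hloc
    have h3 : x * algebraMap O K (∏ l, z l) ^ t * algebraMap O K (∏ l, z l) =
        algebraMap O K a' * algebraMap O K (∏ l, z l) := by
      rw [mul_assoc, ← pow_succ, ha, map_mul]
      ring
    exact mul_right_cancel₀ hPK h3

end Summit.ResolutionOfSingularities.ResolutionOfSingularities.Theorems
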